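import Literature.MathematicalPhysics.QuantumFieldTheory.Balaban1983to89.Beta.ShellValue
import Literature.MathematicalPhysics.QuantumFieldTheory.Balaban1983to89.Beta.DressedMomentNormalisation

/-!
# `BalabanUV.Beta.FP.HorizontalGerm` — road «FP», N7 H-route, (H2-c) JUNCTION: THE `hgerm` LETTER OF THE HORIZONTAL END IS A BY-NAME COROLLARY OF THE TREE
# for every kernel whose second-moment integrand is the LEADING GERM `κ·T(ẑ)` plus a quintic remainder — `|Σ_{0<‖z‖∞≤M} K μ ν z·z_μ·z_ν − 2π²κ·log M| ≤ Cg`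
# for all `M ≥ 1`, `Cg` displayed; at `κ = kappaBal N` the slope is `11N²/(12π²)` ([folklore] composition; nothing of the manuscripts)

HONEST DEPENDENCY (page 1, mandatory): continuum YM on T⁴ ⇐ BetaPertH ∧ nine spine estimates (0/9 proved); BetaPertH ⇐ (D1) ∧ (D4) ∧
CAP+tail; G-an2-4 gates asym, D1 and NE2/3/4.  HONEST FRAMING (cell contract, verbatim): «discharging `BetaPertH` makes Bałaban's UV
stability UNCONDITIONAL — a real constructive-QFT result; it is NOT the continuum limit and NOT the Clay problem.»  THIS MODULE composes BY NAME the lead's ∕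
an3's ∕ strat-b12's tree theorems `DyadicShell.windowLog_of_homogKernel_perturbed`, `LeadingCoefficient.homogKernel_leadingIntegrand` ∕ `coeff_eq_mul` ∕
`slope_of_value` ∕ `transverseValue_pos` ∕ `kappaBal`, `ShellValue.unitCoeff_eq_transverseValue` (`unitCoeff μ ν = 2π²·log 2`, `μ ≠ ν`).  The GERM STATEMENT
(`hrem` below: the kernel's `μν` second-moment integrand is `leadingIntegrand κ μ ν ∘ toReal` up to `C″(‖z‖∞)⁻⁵`, with WHICH `κ`) is a HYPOTHESIS — row H2-OBJ's
analytic content (H2-a,b), supplied nowhere here, asserted of nothing; `κ = kappaBal N` for Bałaban's∕the perfect polarization is the located, UNPRINTED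
identification (cell GAPS G-beta-an3-4) and enters only as the parameter of the arithmetic corollary.  No `def`, no `Prop` fact, 0 sorry.  NOT `hgerm` for Π,
NOT `hasym`, NOT D1, NOT BetaPertH, NOT continuum, NOT Clay.

CONTENT.
* **`hgerm_of_leadingGerm`** — `μ ≠ ν`, `hrem : ∀ r, ∀ w ∈ annulus 4 r (r+1), |K μ ν w·w_μ·w_ν − leadingIntegrand κ μ ν (toReal w)| ≤ C″/(r+1)⁵` ⟹
  `∀ M ≥ 1, |Σ_{z ∈ annulus 4 0 M} K μ ν z·z_μ·z_ν − (2π²κ·log M + 0)| ≤ 1312·(|κ|·24 + |κ|·110592) + |κ|·transverseValue + 160·C″` — EXACTLY the `hgerm` binder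
  of `FP/HorizontalTailAssembly.abs_secondMoment_sub_window_le` ∕ `FP/HorizontalBookkeepingEnd(Letters)` with `s := 2π²κ`, `c₀ := 0`.
* `two_pi_sq_kappaBal` — `2π²·kappaBal N = 11N²/(12π²)`; **`hgerm_stepBal_of_leadingGerm`** — the same at `κ := kappaBal N`, slope `11N²/(12π²)` (= `stepBal N L / log L`,
  `B12Normalization`; the shape `HorizontalEnd.hasym_of_horizontal_stepBal` consumes).
Unit `b2b-balaban-beta-d1-formalise-leaf-02` (gen 6).
-/

noncomputable section

namespace Summit.QuantumFields.BalabanUV.Beta.FP.HorizontalGerm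

open Finset
open Literature.Probability.LatticeModels (annulus)
open Literature.MathematicalPhysics.QuantumFieldTheory.Balaban1983to89
open Literature.MathematicalPhysics.QuantumFieldTheory.Balaban1983to89.Beta
open DyadicShell (Pt supNorm toReal windowLog_of_homogKernel_perturbed)
open LeadingCoefficient (leadingIntegrand transverseValue transverseValue_pos kappaBal homogKernel_leadingIntegrand coeff_eq_mul slope_of_value)
open ShellValue (unitCoeff_eq_transverseValue)
open DressedMomentNormalisation (EKer)

/-- **THE `hgerm` LETTER FROM THE LEADING GERM + A QUINTIC REMAINDER** (`μ ≠ ν`): if the `μν` second-moment integrand of `K` is `κ·T(ẑ)/‖·‖` —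
precisely `|K μ ν w·w_μ·w_ν − leadingIntegrand κ μ ν (toReal w)| ≤ C″/(‖w‖∞)⁵` on every shell — then for every `M ≥ 1`
`|Σ_{0<‖z‖∞≤M} K μ ν z·z_μ·z_ν − (2π²κ·log M + 0)| ≤ 1312·(|κ|·24 + |κ|·110592) + |κ|·transverseValue + 160·C″`. [folklore] -/
theorem hgerm_of_leadingGerm {K : EKer 4} {κ C'' : ℝ} {μ ν : Fin 4} (hμν : μ ≠ ν) (hC'' : 0 ≤ C'')
    (hrem : ∀ r : ℕ, ∀ w ∈ annulus 4 r (r + 1),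
      |K μ ν w * (w μ : ℝ) * (w ν : ℝ) - leadingIntegrand κ μ ν (toReal w)| ≤ C'' / ((r : ℝ) + 1) ^ 5) :
    ∀ M : ℕ, 1 ≤ M →
      |∑ z ∈ annulus 4 0 M, K μ ν z * (z μ : ℝ) * (z ν : ℝ) - (2 * Real.pi ^ 2 * κ * Real.log M + 0)|
        ≤ 1312 * (|κ| * 24 + |κ| * 110592) + |κ| * transverseValue + 160 * C'' := by
  intro M hM
  obtain ⟨I, hI, hwin⟩ := windowLog_of_homogKernel_perturbed (homogKernel_leadingIntegrand κ μ ν) hC''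
    (g := fun w => K μ ν w * (w μ : ℝ) * (w ν : ℝ) - leadingIntegrand κ μ ν (toReal w)) hrem
  have hIval : I = κ * transverseValue := by rw [coeff_eq_mul hI, unitCoeff_eq_transverseValue hμν]
  have h := hwin M hM
  have e1 : ∑ w ∈ annulus 4 0 M, (leadingIntegrand κ μ ν (toReal w) + (K μ ν w * (w μ : ℝ) * (w ν : ℝ) - leadingIntegrand κ μ ν (toReal w)))
      = ∑ z ∈ annulus 4 0 M, K μ ν z * (z μ : ℝ) * (z ν : ℝ) := Finset.sum_congr rfl fun w _ => by ring
  have e2 : I / Real.log 2 = 2 * Real.pi ^ 2 * κ := by rw [hIval, slope_of_value]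
  rw [e1, e2] at h
  have e3 : |I| = |κ| * transverseValue := by rw [hIval, abs_mul, abs_of_pos transverseValue_pos]
  rw [add_zero, ← e3]
  exact h

/-- [folklore] ARITHMETIC: `2π²·kappaBal N = 11N²/(12π²)`. -/
theorem two_pi_sq_kappaBal (N : ℝ) : 2 * Real.pi ^ 2 * kappaBal N = 11 * N ^ 2 / (12 * Real.pi ^ 2) := by
  unfold kappaBal
  have hπ : Real.pi ≠ 0 := Real.pi_ne_zero
  field_simp
  ring

/-- **THE SAME AT `κ := kappaBal N`** — slope `11N²/(12π²)`, the coefficient of `log L` in `B12Normalization.stepBal N L` (`LeadingCoefficient.slope_kappaBal`),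
i.e. the `hgerm` shape of `FP/HorizontalEnd.hasym_of_horizontal_stepBal` read at natural `M` with `c₀ := 0`. [folklore] -/
theorem hgerm_stepBal_of_leadingGerm {K : EKer 4} {C'' : ℝ} (N : ℝ) {μ ν : Fin 4} (hμν : μ ≠ ν) (hC'' : 0 ≤ C'')
    (hrem : ∀ r : ℕ, ∀ w ∈ annulus 4 r (r + 1),
      |K μ ν w * (w μ : ℝ) * (w ν : ℝ) - leadingIntegrand (kappaBal N) μ ν (toReal w)| ≤ C'' / ((r : ℝ) + 1) ^ 5) :
    ∀ M : ℕ, 1 ≤ M →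
      |∑ z ∈ annulus 4 0 M, K μ ν z * (z μ : ℝ) * (z ν : ℝ) - (11 * N ^ 2 / (12 * Real.pi ^ 2) * Real.log M + 0)|
        ≤ 1312 * (|kappaBal N| * 24 + |kappaBal N| * 110592) + |kappaBal N| * transverseValue + 160 * C'' := by
  intro M hM
  have h := hgerm_of_leadingGerm hμν hC'' hrem M hM
  rwa [two_pi_sq_kappaBal] at h

end Summit.QuantumFields.BalabanUV.Beta.FP.HorizontalGerm

end
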